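import Literature.Barriers.RiemannHypothesis.EpsteinZetaCentralValueSharp
import HarnessLib

/-!
# The lattice theta series decomposed by Poisson summation in one variable, and the Mellin integrand of `Λ_z` at `½`

Proof file (no definitions; everything is proved) in the chain
`EpsteinZetaCentralValue.lean` → `EpsteinZetaCentralValueSharp.lean` → this file →
`EpsteinZetaCentralValueExact.lean` → `EpsteinZetaBatemanGrosswaldThm3Proofs.lean`, which ends in
the discharge of `BatemanGrosswald1964_thm3` (Bateman–Grosswald 1964, Theorem 3 (9): the central
value `a^{½}Z(½) = γ + log k − log 4π + 2θk^{−½}e^{−2πk}`, `|θ| < 1`, `k ≥ √3/2`).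

For `z = x + iy ∈ ℍ` let `Θ_z(t) = Σ_{(m,n)∈ℤ²} e^{−πtQ_z(m,n)}`, `Q_z(m,n) = ((mx + n)² + m²y²)/y`
(`Literature.NumberTheory.Automorphic.thetaQ`) and `ϑ = HurwitzZeta.evenKernel 0` (Jacobi's theta
function). This file proves:

* `thetaQ_decomposition` — for `t > 0`,
  `Θ_z(t) = ϑ(t/y) + √(y/t)(ϑ(ty) − 1) + 4√(y/t) Σ_{m,k≥1} e^{−πy(tm² + k²/t)} cos(2πxmk)`:
  the terms `m = 0` give `ϑ(t/y)`; for each `m` the sum over `n` is a Hurwitz even kernel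
  `e^{−πtm²y} evenKernel_{mx}(t/y)` (`hasSum_theta_inner`), transformed by Mathlib's
  `HurwitzZeta.evenKernel_functional_equation` into `√(y/t)e^{−πtm²y} cosKernel_{mx}(y/t)`, whose
  dual terms `k = 0` give `√(y/t)(ϑ(ty) − 1)` and `k ≠ 0` the cosine series
  (`HurwitzZeta.hasSum_nat_cosKernel₀`). This is the `s`-free content of the Chowla–Selberg
  formula, Bateman–Grosswald's (15)–(18).
* `re_f_modif_decomposition` — consequently the Mellin integrand `f̃_z = 𝟙_{t>1}(Θ_z − 1) +
  𝟙_{t<1}(Θ_z − 1/t)` of `Λ₀,z` (`Literature.NumberTheory.Automorphic.thetaFEPair`) splits, for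
  `t ≠ 1`, as `Re f̃_z(t) = H_y(t/y) + t⁻¹H_y(1/(ty)) + 4√(y/t) Σ_{m,k≥1} …` with the ONE-variable
  function `H_y(u) = 𝟙_{u>1/y}(ϑ(u) − 1) + 𝟙_{0<u<1/y}(ϑ(u) − u^{−1/2})` (Mathlib's modified Hurwitz
  kernel `f̃^H`, cut at `1/y` instead of `1`), passed through a defining hypothesis `hH : H = …` so
  that no auxiliary definition is introduced.

## References

* [BatemanGrosswald1964] P. T. Bateman, E. Grosswald, *On Epstein's zeta function*, Acta Arith. 9
  (1964) 365–373, §3, (15)–(18) (read from the page images of the held scan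
  `doi-10-4064-aa-9-4-365-373`).
* Mathlib, `Mathlib/NumberTheory/LSeries/HurwitzZetaEven.lean` (`evenKernel`, `cosKernel`,
  functional equation and series).
-/

noncomputable section

open Complex Filter Topology MeasureTheory Set HurwitzZeta
open scoped UpperHalfPlane

namespace Literature.Barriers.RiemannHypothesis

open Literature.NumberTheory.Automorphic

/-! ## Poisson summation in `n` for fixed `m` -/

/-- For fixed `m`, the inner theta sum over `n` is a Hurwitz even kernel:
`Σ_n e^{−πtQ_z(m,n)} = e^{−πtm²y} · evenKernel_{mx}(t/y)` (`Q_z(m,n) = ((mx+n)² + m²y²)/y`).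
[folklore] -/
theorem hasSum_theta_inner (z : ℍ) {t : ℝ} (ht : 0 < t) (m : ℤ) :
    HasSum (fun n : ℤ => Real.exp (-Real.pi * t * qForm z ![m, n]))
      (Real.exp (-Real.pi * t * (m : ℝ) ^ 2 * z.im) *
        evenKernel (((m : ℝ) * z.re : ℝ) : UnitAddCircle) (t / z.im)) := by
  have hy := z.im_pos
  have h := (hasSum_int_evenKernel ((m : ℝ) * z.re) (div_pos ht hy)).mul_left
    (Real.exp (-Real.pi * t * (m : ℝ) ^ 2 * z.im))
  refine h.congr_fun fun n => ?_
  rw [← Real.exp_add, qForm_apply]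
  congr 1
  simp only [Matrix.cons_val_zero, Matrix.cons_val_one]
  have hy' : z.im ≠ 0 := hy.ne'
  field_simp
  ring

/-- Summing over `m`: `Θ_z(t) = Σ_m e^{−πtm²y} evenKernel_{mx}(t/y)`. [folklore] -/
theorem hasSum_theta_outer (z : ℍ) {t : ℝ} (ht : 0 < t) :
    HasSum (fun m : ℤ => Real.exp (-Real.pi * t * (m : ℝ) ^ 2 * z.im) *
        evenKernel (((m : ℝ) * z.re : ℝ) : UnitAddCircle) (t / z.im)) (thetaQ z t) := by
  have hs : HasSum (fun v : Fin 2 → ℤ => Real.exp (-Real.pi * t * qForm z v)) (thetaQ z t) :=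
    (summable_exp_qForm z ht).hasSum
  have hs2 : HasSum (fun p : ℤ × ℤ => Real.exp (-Real.pi * t * qForm z ![p.1, p.2])) (thetaQ z t) := by
    rw [← (finTwoArrowEquiv ℤ).symm.hasSum_iff] at hs
    simpa [Function.comp_def] using hs
  exact hs2.prod_fiberwise fun m => hasSum_theta_inner z ht m

/-- The theta transformation in the form used: `evenKernel_a(t/y) = √(y/t) · cosKernel_a(y/t)`.
[folklore] -/
theorem evenKernel_div_eq_sqrt_mul_cosKernel (a : UnitAddCircle) (t y : ℝ) :
    evenKernel a (t / y) = Real.sqrt (y / t) * cosKernel a (y / t) := by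
  rw [evenKernel_functional_equation a (t / y), one_div_div, ← Real.sqrt_eq_rpow, one_div,
    ← Real.sqrt_inv, inv_div]

/-- `√(y/t) · ϑ(y/t) = ϑ(t/y)`. [folklore] -/
theorem sqrt_mul_evenKernel_zero (t y : ℝ) :
    Real.sqrt (y / t) * evenKernel 0 (y / t) = evenKernel 0 (t / y) := by
  rw [evenKernel_div_eq_sqrt_mul_cosKernel 0 t y, evenKernel_eq_cosKernel_of_zero]

/-- Summability of the double family `e^{−πy(t(m+1)² + (k+1)²/t)} cos(2πx(m+1)(k+1))` over
`ℕ × ℕ` (`t, y > 0`), with the termwise bound by the product of the two Gaussian factors.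
[folklore] -/
theorem summable_theta_cross {t y : ℝ} (ht : 0 < t) (hy : 0 < y) (x : ℝ) :
    Summable fun p : ℕ × ℕ => Real.exp (-Real.pi * y * (t * ((p.1 : ℝ) + 1) ^ 2 + ((p.2 : ℝ) + 1) ^ 2 / t)) *
      Real.cos (2 * Real.pi * x * ((p.1 : ℝ) + 1) * ((p.2 : ℝ) + 1)) := by
  -- two summable one-variable majorants `e^{−a(n+1)}`
  have hgeo : ∀ {a : ℝ}, 0 < a → Summable fun n : ℕ => Real.exp (-a * ((n : ℝ) + 1) ^ 2) := by
    intro a ha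
    have h1 : Summable fun n : ℕ => Real.exp (-a) * Real.exp ((n : ℝ) * (-a)) :=
      (Real.summable_exp_nat_mul_iff.2 (by linarith)).mul_left _
    refine Summable.of_nonneg_of_le (fun n => (Real.exp_pos _).le) (fun n => ?_) h1
    rw [← Real.exp_add]
    refine Real.exp_le_exp.2 ?_
    have hn : (0 : ℝ) ≤ n := Nat.cast_nonneg n
    nlinarith [mul_nonneg ha.le hn, mul_nonneg ha.le (mul_nonneg hn hn)]
  have hA : Summable fun n : ℕ => Real.exp (-(Real.pi * y * t) * ((n : ℝ) + 1) ^ 2) :=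
    hgeo (by positivity)
  have hB : Summable fun k : ℕ => Real.exp (-(Real.pi * y / t) * ((k : ℝ) + 1) ^ 2) :=
    hgeo (by positivity)
  have hprod := hA.mul_of_nonneg hB (fun _ => (Real.exp_pos _).le) (fun _ => (Real.exp_pos _).le)
  refine Summable.of_norm_bounded hprod fun p => ?_
  rw [Real.norm_eq_abs, abs_mul, Real.abs_exp]
  refine le_trans (mul_le_of_le_one_right (Real.exp_pos _).le (Real.abs_cos_le_one _)) (le_of_eq ?_)
  rw [← Real.exp_add]
  congr 1
  field_simp
  ring

/-- **The theta series decomposed** (`y = Im z`, `x = Re z`, `t > 0`):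
`Θ_z(t) = ϑ(t/y) + √(y/t)(ϑ(ty) − 1) + 4√(y/t) Σ_{m,k≥1} e^{−πy(tm² + k²/t)} cos(2πxmk)`,
`ϑ = evenKernel 0` — the terms `m = 0`, and Poisson summation in `n` for `m ≠ 0` (dual terms
`k = 0` and `k ≠ 0`). This is the `s`-free content of the Chowla–Selberg formula.
[cite: BatemanGrosswald1964, (15)–(18)] -/
theorem thetaQ_decomposition (z : ℍ) {t : ℝ} (ht : 0 < t) :
    thetaQ z t = evenKernel 0 (t / z.im) + Real.sqrt (z.im / t) * (evenKernel 0 (t * z.im) - 1) +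
      4 * Real.sqrt (z.im / t) * ∑' p : ℕ × ℕ,
        Real.exp (-Real.pi * z.im * (t * ((p.1 : ℝ) + 1) ^ 2 + ((p.2 : ℝ) + 1) ^ 2 / t)) *
          Real.cos (2 * Real.pi * z.re * ((p.1 : ℝ) + 1) * ((p.2 : ℝ) + 1)) := by
  have hy : 0 < z.im := z.im_pos
  have hyt : 0 < z.im / t := div_pos hy ht
  have hsq : 0 < Real.sqrt (z.im / t) := Real.sqrt_pos.2 hyt
  -- the families
  set E : ℤ → ℝ := fun m => Real.exp (-Real.pi * t * (m : ℝ) ^ 2 * z.im) with hE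
  set G : ℤ → ℝ := fun m =>
    E m * (cosKernel (((m : ℝ) * z.re : ℝ) : UnitAddCircle) (z.im / t) - 1) with hG
  set P : ℕ × ℕ → ℝ := fun p =>
    Real.exp (-Real.pi * z.im * (t * ((p.1 : ℝ) + 1) ^ 2 + ((p.2 : ℝ) + 1) ^ 2 / t)) *
      Real.cos (2 * Real.pi * z.re * ((p.1 : ℝ) + 1) * ((p.2 : ℝ) + 1)) with hP
  -- (1) the outer sum and the functional equation termwise
  have hF := hasSum_theta_outer z ht
  have hFG : ∀ m : ℤ, Real.exp (-Real.pi * t * (m : ℝ) ^ 2 * z.im) *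
      evenKernel (((m : ℝ) * z.re : ℝ) : UnitAddCircle) (t / z.im) =
      Real.sqrt (z.im / t) * E m + Real.sqrt (z.im / t) * G m := fun m => by
    rw [evenKernel_div_eq_sqrt_mul_cosKernel _ t z.im]
    simp only [hG, hE]
    ring
  simp_rw [hFG] at hF
  -- (2) `Σ_m E m = ϑ(ty)`
  have hEsum : HasSum E (evenKernel 0 (t * z.im)) := by
    have h := hasSum_int_evenKernel 0 (mul_pos ht hy)
    simp only [add_zero, QuotientAddGroup.mk_zero] at h
    refine h.congr_fun fun m => ?_
    simp only [hE]
    ring_nf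
  -- (3) hence `Σ_m √(y/t) G m = Θ − √(y/t) ϑ(ty)`
  have hGsum : HasSum (fun m => Real.sqrt (z.im / t) * G m)
      (thetaQ z t - Real.sqrt (z.im / t) * evenKernel 0 (t * z.im)) := by
    have h := hF.sub (hEsum.mul_left (Real.sqrt (z.im / t)))
    refine h.congr_fun fun m => ?_
    ring
  -- (4) the term `m = 0`, evenness, and passage to `n ≥ 1`
  have hG0 : Real.sqrt (z.im / t) * G 0 = evenKernel 0 (t / z.im) - Real.sqrt (z.im / t) := by
    have e0 : G 0 = evenKernel 0 (z.im / t) - 1 := by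
      simp only [hG, hE, Int.cast_zero, zero_mul, QuotientAddGroup.mk_zero,
        ← evenKernel_eq_cosKernel_of_zero]
      simp
    rw [e0, mul_sub, sqrt_mul_evenKernel_zero t z.im, mul_one]
  have hGeven : ∀ m : ℤ, G (-m) = G m := fun m => by
    simp only [hG, hE, Int.cast_neg, neg_mul, even_two.neg_pow]
    rw [show (((-((m : ℝ) * z.re) : ℝ)) : UnitAddCircle) = -((((m : ℝ) * z.re : ℝ)) : UnitAddCircle)
      from rfl, cosKernel_neg]
  have hnat := hGsum.nat_add_neg
  rw [← hasSum_nat_add_iff' 1] at hnat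
  simp only [Finset.sum_range_one, Nat.cast_zero, Nat.cast_add, Nat.cast_one] at hnat
  -- (5) the inner sums over `k`
  have hPsum : Summable P := summable_theta_cross ht hy z.re
  have hinner : ∀ n : ℕ, HasSum (fun k : ℕ => P (n, k)) (G ((n : ℤ) + 1) / 2) := fun n => by
    have h := (hasSum_nat_cosKernel₀ (((n : ℝ) + 1) * z.re) hyt).mul_left (E ((n : ℤ) + 1) / 2)
    have hval : E ((n : ℤ) + 1) / 2 *
        (cosKernel ((((n : ℝ) + 1) * z.re : ℝ) : UnitAddCircle) (z.im / t) - 1) = G ((n : ℤ) + 1) / 2 := by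
      simp only [hG]
      push_cast
      ring
    rw [hval] at h
    refine h.congr_fun fun k => ?_
    simp only [hP, hE]
    push_cast
    rw [show Real.exp (-Real.pi * z.im * (t * ((n : ℝ) + 1) ^ 2 + ((k : ℝ) + 1) ^ 2 / t)) =
      Real.exp (-Real.pi * t * ((n : ℝ) + 1) ^ 2 * z.im) *
        Real.exp (-Real.pi * ((k : ℝ) + 1) ^ 2 * (z.im / t)) by
          rw [← Real.exp_add]; congr 1; field_simp; ring]
    ring_nf
  have hfib := hPsum.hasSum.prod_fiberwise hinner
  -- (6) compare the two expressions for `Σ_n G(n+1)`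
  have h4 : HasSum (fun n : ℕ => Real.sqrt (z.im / t) * G ((n : ℤ) + 1) +
      Real.sqrt (z.im / t) * G (-((n : ℤ) + 1))) (4 * Real.sqrt (z.im / t) * ∑' p, P p) := by
    have h := hfib.mul_left (4 * Real.sqrt (z.im / t))
    refine h.congr_fun fun n => ?_
    rw [hGeven]
    ring
  have huniq := hnat.unique h4
  have e1 : Real.sqrt (z.im / t) * (evenKernel 0 (t * z.im) - 1) =
      Real.sqrt (z.im / t) * evenKernel 0 (t * z.im) - Real.sqrt (z.im / t) := by ring
  linarith [huniq, hG0, e1]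


/-! ## The Mellin integrand decomposed: `Re f̃_z = H_y(t/y) + t⁻¹ H_y(1/(ty)) + C(t)` off `t = 1` -/

/-- `(t/y)^{−1/2} = √(y/t)`. [folklore] -/
theorem div_rpow_neg_half {t y : ℝ} (ht : 0 < t) (hy : 0 < y) :
    (t / y) ^ (-(1 / 2 : ℝ)) = Real.sqrt (y / t) := by
  rw [Real.rpow_neg (div_pos ht hy).le, ← Real.sqrt_eq_rpow, ← Real.sqrt_inv, inv_div]

/-- `(1/(ty))^{−1/2} = √(ty)`. [folklore] -/
theorem one_div_rpow_neg_half {t y : ℝ} (ht : 0 < t) (hy : 0 < y) :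
    (1 / (t * y)) ^ (-(1 / 2 : ℝ)) = Real.sqrt (t * y) := by
  rw [Real.rpow_neg (by positivity), ← Real.sqrt_eq_rpow, one_div, Real.sqrt_inv, inv_inv]

/-- `ϑ(1/(ty)) = √(ty) ϑ(ty)`. [folklore] -/
theorem evenKernel_one_div_mul {t y : ℝ} (ht : 0 < t) (hy : 0 < y) :
    evenKernel 0 (1 / (t * y)) = Real.sqrt (t * y) * evenKernel 0 (t * y) := by
  have hs : Real.sqrt (t * y) ≠ 0 := (Real.sqrt_pos.2 (mul_pos ht hy)).ne'
  rw [evenKernel_zero_functional_equation (t * y)]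
  field_simp

/-- `t⁻¹ √(ty) = √(y/t)` (`t > 0`). [folklore] -/
theorem inv_mul_sqrt_mul {t y : ℝ} (ht : 0 < t) (hy : 0 < y) :
    t⁻¹ * Real.sqrt (t * y) = Real.sqrt (y / t) := by
  rw [show y / t = t * y / t ^ 2 by field_simp, Real.sqrt_div' _ (sq_nonneg t), Real.sqrt_sq ht.le]
  ring

/-- **The Mellin integrand decomposed.** With `y = Im z`, `x = Re z`, `ϑ = evenKernel 0` and
`H_y(u) = 𝟙_{(1/y,∞)}(u)(ϑ(u) − 1) + 𝟙_{(0,1/y)}(u)(ϑ(u) − u^{−1/2})`, for `t > 0`, `t ≠ 1`: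
`Re f̃_z(t) = H_y(t/y) + t⁻¹ H_y(1/(ty)) + 4√(y/t) Σ_{m,k≥1} e^{−πy(tm²+k²/t)} cos(2πxmk)`
(`f̃_z = 𝟙_{t>1}(Θ_z − 1) + 𝟙_{t<1}(Θ_z − 1/t)`, `thetaQ_decomposition`, and `ϑ(1/(ty)) = √(ty)ϑ(ty)`).
[folklore] -/
theorem re_f_modif_decomposition (z : ℍ) {H : ℝ → ℝ}
    (hH : H = fun u => (Ioi (1 / z.im)).indicator (fun u => evenKernel 0 u - 1) u +
      (Ioo 0 (1 / z.im)).indicator (fun u => evenKernel 0 u - u ^ (-(1 / 2 : ℝ))) u)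
    {t : ℝ} (ht : 0 < t) (ht1 : t ≠ 1) :
    ((thetaFEPair z).f_modif t).re = H (t / z.im) + t⁻¹ * H (1 / (t * z.im)) +
      4 * Real.sqrt (z.im / t) * ∑' p : ℕ × ℕ,
        Real.exp (-Real.pi * z.im * (t * ((p.1 : ℝ) + 1) ^ 2 + ((p.2 : ℝ) + 1) ^ 2 / t)) *
          Real.cos (2 * Real.pi * z.re * ((p.1 : ℝ) + 1) * ((p.2 : ℝ) + 1)) := by
  have hy : 0 < z.im := z.im_pos
  have hiy : 0 < 1 / z.im := one_div_pos.2 hy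
  have hdec := thetaQ_decomposition z ht
  set C := 4 * Real.sqrt (z.im / t) * ∑' p : ℕ × ℕ,
        Real.exp (-Real.pi * z.im * (t * ((p.1 : ℝ) + 1) ^ 2 + ((p.2 : ℝ) + 1) ^ 2 / t)) *
          Real.cos (2 * Real.pi * z.re * ((p.1 : ℝ) + 1) * ((p.2 : ℝ) + 1)) with hC
  have hFE := evenKernel_one_div_mul ht hy
  have hts := inv_mul_sqrt_mul ht hy
  rcases lt_or_gt_of_ne ht1 with h1 | h1
  · -- `t < 1`: `Re f̃ = Θ − 1/t`, `H(t/y) = ϑ(t/y) − √(y/t)`, `t⁻¹H(1/(ty)) = √(y/t)ϑ(ty) − 1/t`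
    have hA : t / z.im ∉ Ioi (1 / z.im) := fun h => by
      have : 1 / z.im < t / z.im := h
      rw [div_lt_div_iff_of_pos_right hy] at this; linarith
    have hA' : t / z.im ∈ Ioo 0 (1 / z.im) :=
      ⟨div_pos ht hy, by rw [div_lt_div_iff_of_pos_right hy]; exact h1⟩
    have hB : 1 / (t * z.im) ∈ Ioi (1 / z.im) := by
      show 1 / z.im < 1 / (t * z.im)
      rw [div_lt_div_iff_of_pos_left one_pos hy (by positivity)]; nlinarith
    have hB' : 1 / (t * z.im) ∉ Ioo 0 (1 / z.im) := fun h => lt_irrefl _ (lt_trans h.2 hB)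
    have eH1 : H (t / z.im) = evenKernel 0 (t / z.im) - Real.sqrt (z.im / t) := by
      rw [hH]; simp only
      rw [indicator_of_notMem hA, indicator_of_mem hA', zero_add, div_rpow_neg_half ht hy]
    have eH2 : H (1 / (t * z.im)) = evenKernel 0 (1 / (t * z.im)) - 1 := by
      rw [hH]; simp only
      rw [indicator_of_mem hB, indicator_of_notMem hB', add_zero]
    rw [re_f_modif_of_mem_Ioo z ⟨ht, h1⟩, eH1, eH2, hFE, hdec]
    have e3 : t⁻¹ * (Real.sqrt (t * z.im) * evenKernel 0 (t * z.im) - 1) =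
        Real.sqrt (z.im / t) * evenKernel 0 (t * z.im) - t⁻¹ := by rw [mul_sub, ← mul_assoc, hts, mul_one]
    rw [e3]
    ring
  · -- `t > 1`: `Re f̃ = Θ − 1`, `H(t/y) = ϑ(t/y) − 1`, `t⁻¹H(1/(ty)) = √(y/t)ϑ(ty) − √(y/t)`
    have hA : t / z.im ∈ Ioi (1 / z.im) := by
      show 1 / z.im < t / z.im
      rw [div_lt_div_iff_of_pos_right hy]; exact h1
    have hA' : t / z.im ∉ Ioo 0 (1 / z.im) := fun h => lt_irrefl _ (lt_trans h.2 hA)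
    have hB : 1 / (t * z.im) ∉ Ioi (1 / z.im) := fun h => by
      have : 1 / z.im < 1 / (t * z.im) := h
      rw [div_lt_div_iff_of_pos_left one_pos hy (by positivity)] at this; nlinarith
    have hB' : 1 / (t * z.im) ∈ Ioo 0 (1 / z.im) := by
      refine ⟨by positivity, ?_⟩
      show 1 / (t * z.im) < 1 / z.im
      rw [div_lt_div_iff_of_pos_left one_pos (by positivity) hy]; nlinarith
    have eH1 : H (t / z.im) = evenKernel 0 (t / z.im) - 1 := by
      rw [hH]; simp only
      rw [indicator_of_mem hA, indicator_of_notMem hA', add_zero]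
    have eH2 : H (1 / (t * z.im)) = evenKernel 0 (1 / (t * z.im)) - Real.sqrt (t * z.im) := by
      rw [hH]; simp only
      rw [indicator_of_notMem hB, indicator_of_mem hB', zero_add, one_div_rpow_neg_half ht hy]
    rw [re_f_modif_of_one_lt z h1, eH1, eH2, hFE, hdec]
    have e3 : t⁻¹ * (Real.sqrt (t * z.im) * evenKernel 0 (t * z.im) - Real.sqrt (t * z.im)) =
        Real.sqrt (z.im / t) * evenKernel 0 (t * z.im) - Real.sqrt (z.im / t) := by
      rw [mul_sub, ← mul_assoc, hts]
    rw [e3]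
    ring


end Literature.Barriers.RiemannHypothesis
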